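import Summits.QuantumAdvantage.QuantumAdvantage.Theorems.LinnikCubicClassGroupsDegreeOnePrimesEscapeCMClassNumber
import HarnessLib

/-!
# Only finitely many CM fields of a given degree have bounded class number (Hermite form)

Topic `Summits/QuantumAdvantage/QuantumAdvantage/Theorems`, helper file for the crux
`DegreeOnePrimesEscape` (stmt-QuantumAdvantage-11543, closed) of route `LinnikCubicClassGroups`;
cell B2b-1 (linnik-cubic), PART A. HONEST FRAMING: the value of this file is a THEOREM — NOT summit
progress.

`…CMClassNumber.lean` proved (`CMField.absdiscr_le_of_classNumber_le`) that for `n ≥ 2` and every `H`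
the CM fields `K` of degree `2n` with `h_K ≤ H` have bounded discriminant.  With Hermite's theorem
(Mathlib `NumberField.finite_of_discr_bdd`: inside a fixed field `A` of characteristic zero only
finitely many number fields have `|d_K| ≤ N`) this becomes the finiteness statement itself:

* `finite_setOf_isCMField_classNumber_le` — **for every field `A` of characteristic `0`, every `n ≥ 2`
  and every `H`, the set of subfields `K ⊆ A`, finite over `ℚ`, which are CM fields of degree `2n`
  with class number `h_K ≤ H` is finite** (e.g. `A = ℂ` or `A = ℚ̄`: finitely many CM fields of
  degree `2n` and class number `≤ H` up to isomorphism).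

In print: the class number `h` problem for CM fields (Stark 1974, Odlyzko 1975, Hoffstein 1979),
fixed-degree part.

## References

* H. M. Stark, *Some effective cases of the Brauer–Siegel theorem*, Invent. Math. 23 (1974)
  135–152, Thm. 2. [Stark1974]
-/

noncomputable section

open scoped NumberField
open NumberField

namespace Summit.QuantumAdvantage.QuantumAdvantage.Theorems.DegreeOnePrimesEscape

namespace CMField

/-- **Finitely many CM fields of degree `2n` with class number `≤ H`** (inside any field `A` of
characteristic zero, e.g. `ℂ`): the set of `K ⊆ A` finite over `ℚ` with `K` CM, `[K:ℚ] = 2n` and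
`h_K ≤ H` is finite. (`absdiscr_le_of_classNumber_le` + Hermite's theorem.)
[cite: Stark1974, Thm. 2 (context)] -/
theorem finite_setOf_isCMField_classNumber_le (A : Type) [Field A] [CharZero A] (n : ℕ)
    (hn : 2 ≤ n) (H : ℝ) :
    {K : { F : IntermediateField ℚ A // FiniteDimensional ℚ F } |
      haveI : NumberField K := @NumberField.mk _ _ inferInstance K.prop
      IsCMField K ∧ Module.finrank ℚ K = 2 * n ∧ (classNumber K : ℝ) ≤ H }.Finite := by
  obtain ⟨D, hD⟩ := absdiscr_le_of_classNumber_le n hn H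
  refine Set.Finite.subset (NumberField.finite_of_discr_bdd A ⌈max D 0⌉₊) ?_
  rintro ⟨K, hK₀⟩ hK
  haveI : NumberField K := @NumberField.mk _ _ inferInstance hK₀
  obtain ⟨hCM, hdeg, hh⟩ := hK
  haveI : IsCMField K := hCM
  have hd : ((discr K).natAbs : ℝ) ≤ D := hD K hdeg hh
  have hdN : (discr K).natAbs ≤ ⌈max D 0⌉₊ := by
    have h1 : ((discr K).natAbs : ℝ) ≤ ⌈max D 0⌉₊ :=
      (hd.trans (le_max_left _ _)).trans (Nat.le_ceil _)
    exact_mod_cast h1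
  show |discr K| ≤ (⌈max D 0⌉₊ : ℤ)
  rw [Int.abs_eq_natAbs]
  exact_mod_cast hdN

end CMField

end Summit.QuantumAdvantage.QuantumAdvantage.Theorems.DegreeOnePrimesEscape

end
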